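import Summits.Ventures.HSemireg.Pad4TowerLinePhaseRigidityPhaseType

/-!
# Pad4Tower ∕ LinePhaseRigidity — Part L THE FC SHAPE LAW BELOW TWELVE (h-uniform, PROVED): FC `N`-cells are pure; FC `P`-cells are pure or the unit cell `P[1_k,1_k,1_{k+2},1_{k+2}]` — `fcShapeLine_of_lt_twelve`
# (HSemireg support file; PT-PORT-2 (a3), tree copy of control's crux workfile)

Crux of record: `Summit.HodgeConjecture.HodgeConjecture.Theses.EightfoldBlochSeeds.BlochSeedDiscOne` (= `HasHyperbolicBlochSeed 4 1`, item
stmt-HodgeConjecture-18881; skeleton `Cruxes/BlochSeedDiscOne/Lines/birth.lean` 814a6a70c14e831a, STUB R `stub_rung_pad4_seedAt`, UNTOUCHED).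
Nothing in this file proves HC, HC_AV, HC_CM, H2, item 18881, (T₈) or (T₁₀); census-neutral (no SAT∕UNSAT row is added or changed). Statements about
the typed FIRST-ORDER static game on the LINE alphabet of the PAD-4 design tower (`RuleDMu4Closed`, `XPlusClosed`, `G1Closed` of record) — H₁-static
letter DESIGNS, not sheaves, monads or seeds; HC_CM is a displayed binder of the ladder only, unused here.

PROVENANCE. TREE COPY — statements AND proofs verbatim; new are only the namespace `Summit.Ventures.HSemireg.Pad4Tower.LinePhaseRigidity`, this module docstring, the module boundary, the
`open` of the tree toolkit namespace `…Pad4Tower.LineInertia` (= the workfile's Part A), one-line docstrings where the gate requires them, and these dedups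
to the tree (the one the key allows: Part J's `fin4_add_two_ne : ∀ k : Fin 4, k + 2 ≠ k` is NOT re-declared — its uses call the toolkit's identical `LineInertia.add_two_ne` —
and `…Nucleus1`'s dropped `decide` fact `fin4_add_two_two : ∀ k : Fin 4, k + 2 + 2 = k` (a foreign-summit near-duplicate) is used inline at its two places here)
of Part L of the crux workfile `Cruxes/BlochSeedDiscOne/LinePhaseRigidity.lean` v1.9 (author plan-lens-HodgeAV-control g9; crux commit f5c30e1c3066, sha16 f0ad6d2122a71d9c; critic plates idea-crit-6 g15 PASS). Filed in the tree on plan-lens-HodgeAV-control g10's KEY (a3) (bus l.10147: «Parts G–L up to `oddFCFreeLine_of_lt_twelve`,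
`not_oddFCFreeLine_twelve`, `fcShapeLine_of_lt_twelve` → tree, so that `DiamondLevelLaws.OddLineFree h` (∀ h < 12) is a tree theorem and the displayed
hypothesis of `oddThreshold_iff_lineNest` is discharged by name» — control's wording; `DiamondLevelLaws.OddLineFree` ∕ `oddThreshold_iff_lineNest` are declarations of the
crux workfile `Cruxes/BlochSeedDiscOne/DiamondLevelLaws.lean`, NOT of this chain) by hsemireg-phasetorus-typer-1 g3 (v3 docstring∕dedup hygiene by typer-1 g5). Module set of (a3), each importing the previous, on top of
(a2)'s `Pad4TowerLinePhaseRigidityGap`: `Pad4TowerLinePhaseRigidityTags` (Part G) → `…Parity` (Parts H, I) → `…Nucleus1` (Part J, first half) → `…Nucleus2` (Part J, second half: `oddFCFreeLine_of_lt_twelve`, `oddLineThresholdLaw_holds`) → `…PhaseType` (Part K) → `…Shape` (Part L: `fcShapeLine_of_lt_twelve`). 0 sorry, 0 named facts, no instance ∕ notation ∕ set_option ∕ native_decide; docstring on every declaration.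

CONTENT. In `namespace LineModel`: `units_0002_absent`, `fcP_shape_below_twelve` (with Part K's `fcP_tags_const_of_two`); top level: **`fcShapeLine_of_lt_twelve (hh : h < 12) : LSupport h C → G1Closed → RuleDMu4Closed → XPlusClosed → (∀ Z ∈ C.lower, FCc Z → PureCell h Z) ∧ (∀ Z ∈ C.upper, FCc Z → PureCell h Z ∨ ∃ k a b c d …)`** — the census's SAT cell at ten (the tree certificate `Pad4TowerLineDesignCert10` realises it) is the only non-pure FC shape below twelve.
-/

namespace Summit.Ventures.HSemireg.Pad4Tower.LinePhaseRigidity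

open Finset Summit.Ventures.HSemireg.Pad4Tower Summit.Ventures.HSemireg.LinePhaseTorus Summit.Ventures.HSemireg.Pad4Tower.LineInertia

/-! ## Part L — THE FC SHAPE LAW BELOW TWELVE (h-uniform, PROVED): FC `N`-cells are pure; FC `P`-cells are pure or `P[1_k,1_k,1_{k+2},1_{k+2}]`

The last non-pure antipodal shape below twelve, the unit cell of type `0002` (charge-2 letters force four equal tags, `fcP_tags_const_of_two`),
dies by the 22-literal UP chain of the crux-workfile script `upchain.py 10 'P:1_0,1_0,1_0,1_2'` (`UPCHAIN-h10-0002.txt` there) read h-uniformly (`units_0002_absent`); so the FC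
census of the LINE below twelve is: pure cells, plus the unit `0022` cell (MACHINE: SAT from ten) — `fcP_shape_below_twelve`, `fcShapeLine_of_lt_twelve`. -/

namespace LineModel

variable {h : ℤ} {vN vP : ACell → Prop}

/-- **THE `0002`-TYPE UNIT CELL IS ABSENT below twelve (PROVED)**: `U = P[1_k@a, 1_k@b, 1_k@c, 1_{k+2}@d]`.  Chain: in the hub
`N1 = U[a ≔ apex]` the unit `b` raises to exactly `2` (`raise3`), `Vr = P[·, 2_k, 1_k, 1_{k+2}]`; its unit siblings `Vr[d ≔ 1_k]`, `Vr[c ≔ 1_{k+2}]`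
are absent; the second (swap `b ↔ d`, shift `2`) is the charge-2 raise of `d` in `N1`, so `d` raises to `3`: `W1 = P[·, 1_k, 1_k, 3_{k+2}]`, whose
hub `W1[b ≔ apex]` raises `d` to `4`: `Q1 = P[·, ·, 1_k, 4_{k+2}]`; the first feeds `w_of` at `N2 = U[d ≔ apex]`: `W2 = P[3_k, 1_k, 1_k, ·]`, and `Q1`
(swap `a ↔ d`, shift `2`) is `P[4_k, ·, 1_{k+2}, ·]`, the sibling excluded by `top3_sibling4` at `W2`. -/
theorem units_0002_absent (M : LineModel h vN vP) (hh : h < 12) {U : ACell} (hU : vP U) {a b c d : Fin 4} (hab : a ≠ b)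
    (hac : a ≠ c) (had : a ≠ d) (hbc : b ≠ c) (hbd : b ≠ d) (hcd : c ≠ d) (ha1 : (U a).1 = 1) (hb1 : (U b).1 = 1)
    (hc1 : (U c).1 = 1) (hd1 : (U d).1 = 1) (hb2 : (U b).2 = (U a).2) (hc2 : (U c).2 = (U a).2)
    (hd2 : (U d).2 = (U a).2 + 2) : False := by
  have ha : U a = (1, (U a).2) := Prod.ext ha1 rfl
  have hb : U b = (1, (U a).2) := Prod.ext hb1 hb2
  have hc : U c = (1, (U a).2) := Prod.ext hc1 hc2
  have hd : U d = (1, (U a).2 + 2) := Prod.ext hd1 hd2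
  -- the hub `N1 = U[a ≔ apex]`; the unit `b` raises to exactly `2`
  have hN1 := M.unit_hub hU ha1 0
  have e1a : Function.update U a ((0 : ℕ), (0 : Fin 4)) a = (0, 0) := Function.update_self _ _ _
  have e1b : Function.update U a ((0 : ℕ), (0 : Fin 4)) b = (1, (U a).2) := by rw [Function.update_of_ne hab.symm, hb]
  have e1c : Function.update U a ((0 : ℕ), (0 : Fin 4)) c = (1, (U a).2) := by rw [Function.update_of_ne hac.symm, hc]
  have e1d : Function.update U a ((0 : ℕ), (0 : Fin 4)) d = (1, (U a).2 + 2) := by rw [Function.update_of_ne had.symm, hd]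
  have h1a0 : (Function.update U a ((0 : ℕ), (0 : Fin 4)) a).1 = 0 := by rw [e1a]
  have h1b1 : (Function.update U a ((0 : ℕ), (0 : Fin 4)) b).1 = 1 := by rw [e1b]
  have h1c1 : (Function.update U a ((0 : ℕ), (0 : Fin 4)) c).1 = 1 := by rw [e1c]
  have h1d1 : (Function.update U a ((0 : ℕ), (0 : Fin 4)) d).1 = 1 := by rw [e1d]
  obtain ⟨c₁, h1lt, h1le, hVr, h1t⟩ := M.raise3 hh hN1 hbc hbd hab.symm hcd hac.symm had.symm (one_le_of_eq_one h1b1)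
    (one_le_of_eq_one h1c1) (one_le_of_eq_one h1d1) h1a0
  rw [h1b1] at h1lt
  have hc₁ : c₁ = 2 := by
    rcases (by omega : c₁ = 2 ∨ c₁ = 3) with e | e
    · exact e
    · exfalso
      have := h1t e
      rw [e1c, e1d] at this
      exact add_two_ne (U a).2 this.symm
  subst hc₁
  rw [show (Function.update U a ((0 : ℕ), (0 : Fin 4)) b).2 = (U a).2 by rw [e1b]] at hVr
  have eVa : Function.update (Function.update U a ((0 : ℕ), (0 : Fin 4))) b (2, (U a).2) a = (0, 0) := by
    rw [Function.update_of_ne hab, e1a]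
  have eVb : Function.update (Function.update U a ((0 : ℕ), (0 : Fin 4))) b (2, (U a).2) b = (2, (U a).2) :=
    Function.update_self _ _ _
  have eVc : Function.update (Function.update U a ((0 : ℕ), (0 : Fin 4))) b (2, (U a).2) c = (1, (U a).2) := by
    rw [Function.update_of_ne hbc.symm, e1c]
  have eVd : Function.update (Function.update U a ((0 : ℕ), (0 : Fin 4))) b (2, (U a).2) d = (1, (U a).2 + 2) := by
    rw [Function.update_of_ne hbd.symm, e1d]
  -- the two unit siblings of `Vr` are absent
  have hSd := M.unit_sibling hVr (s := d) (f := a) had (by rw [eVa]) (by rw [eVd]) (k'' := (U a).2)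
    (by rw [eVd]; exact (add_two_ne _).symm)
  have hSc := M.unit_sibling hVr (s := c) (f := a) hac (by rw [eVa]) (by rw [eVc]) (k'' := (U a).2 + 2)
    (by rw [eVc]; exact add_two_ne _)
  -- the unit `d` of `N1` raises to exactly `3`: `W1`
  obtain ⟨c₂, h2lt, h2le, hW1, -⟩ := M.raise3 hh hN1 hbd.symm hcd.symm had.symm hbc hab.symm hac.symm (one_le_of_eq_one h1d1)
    (one_le_of_eq_one h1b1) (one_le_of_eq_one h1c1) h1a0
  rw [h1d1] at h2lt
  rw [show (Function.update U a ((0 : ℕ), (0 : Fin 4)) d).2 = (U a).2 + 2 by rw [e1d]] at hW1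
  have hc₂ : c₂ = 3 := by
    rcases (by omega : c₂ = 2 ∨ c₂ = 3) with e | e
    · exfalso
      subst e
      apply hSc
      have hS := M.shiftP_by (M.permP _ hW1 (Equiv.swap b d)) 2
      refine M.congrP hS (fun i => ?_)
      dsimp only
      rcases fin4_cover hab hac had hbc hbd hcd i with hi | hi | hi | hi <;> rw [hi]
      · right
        rw [Equiv.swap_apply_of_ne_of_ne hab had, Function.update_of_ne had, e1a, Function.update_of_ne hac, eVa]
        exact ⟨rfl, rfl⟩
      · left
        rw [Equiv.swap_apply_left, Function.update_self, Function.update_of_ne hbc, eVb]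
        exact Prod.ext rfl ((by decide : ∀ k : Fin 4, k + 2 + 2 = k) _)
      · left
        rw [Equiv.swap_apply_of_ne_of_ne hbc.symm hcd, Function.update_of_ne hcd, e1c, Function.update_self]
      · left
        rw [Equiv.swap_apply_right, Function.update_of_ne hbd, e1b, Function.update_of_ne hcd.symm,
          Function.update_of_ne hbd.symm, e1d]
    · exact e
  subst hc₂
  -- the hub `W1[b ≔ apex]` raises `d` to `4`: `Q1 = P[·, ·, 1_k, 4_{k+2}]`
  have eW1b : Function.update (Function.update U a ((0 : ℕ), (0 : Fin 4))) d (3, (U a).2 + 2) b = (1, (U a).2) := by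
    rw [Function.update_of_ne hbd, e1b]
  have hH1 := M.unit_hub hW1 (s := b) (by rw [eW1b]) 0
  have eH1d : Function.update (Function.update (Function.update U a ((0 : ℕ), (0 : Fin 4))) d (3, (U a).2 + 2)) b
      ((0 : ℕ), (0 : Fin 4)) d = (3, (U a).2 + 2) := by
    rw [Function.update_of_ne hbd.symm, Function.update_self]
  have eH1c : Function.update (Function.update (Function.update U a ((0 : ℕ), (0 : Fin 4))) d (3, (U a).2 + 2)) b
      ((0 : ℕ), (0 : Fin 4)) c = (1, (U a).2) := by
    rw [Function.update_of_ne hbc.symm, Function.update_of_ne hcd, e1c]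
  obtain ⟨c₃, h3lt, h3le, hQ1⟩ := M.raise2 hh hH1 (g := d) (b := c) hcd.symm (by rw [eH1d]; omega)
    (one_le_of_eq_one (by rw [eH1c]))
  rw [show (Function.update (Function.update (Function.update U a ((0 : ℕ), (0 : Fin 4))) d (3, (U a).2 + 2)) b
      ((0 : ℕ), (0 : Fin 4)) d).1 = 3 by rw [eH1d]] at h3lt
  have hc₃ : c₃ = 4 := by omega
  subst hc₃
  rw [show (Function.update (Function.update (Function.update U a ((0 : ℕ), (0 : Fin 4))) d (3, (U a).2 + 2)) b
      ((0 : ℕ), (0 : Fin 4)) d).2 = (U a).2 + 2 by rw [eH1d]] at hQ1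
  -- the other hub `N2 = U[d ≔ apex]`: `w_of` (fed by the absent sibling `Vr[d ≔ 1_k]`) gives `W2 = N2[a ≔ 3_k]`
  have hN2 := M.unit_hub hU hd1 0
  have e2a : Function.update U d ((0 : ℕ), (0 : Fin 4)) a = (1, (U a).2) := by rw [Function.update_of_ne had, ha]
  have e2b : Function.update U d ((0 : ℕ), (0 : Fin 4)) b = (1, (U a).2) := by rw [Function.update_of_ne hbd, hb]
  have e2c : Function.update U d ((0 : ℕ), (0 : Fin 4)) c = (1, (U a).2) := by rw [Function.update_of_ne hcd, hc]
  have e2d : Function.update U d ((0 : ℕ), (0 : Fin 4)) d = (0, 0) := Function.update_self _ _ _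
  have hW2 := M.w_of hh hN2 hab hac had hbc hbd hcd e2a e2b e2c (by rw [e2d])
    (V := Function.update (Function.update (Function.update U a ((0 : ℕ), (0 : Fin 4))) b (2, (U a).2)) d (1, (U a).2))
    (by rw [Function.update_of_ne had, eVa]) (by rw [Function.update_of_ne hbd, eVb]) (by rw [Function.update_of_ne hcd, eVc])
    (Function.update_self _ _ _) hSd
  -- `Q1` swapped `a ↔ d` and shifted by `2` is the sibling `P[4_k, ·, 1_{k+2}, ·]` excluded by `top3_sibling4` at `W2`
  refine M.top3_sibling4 hh hW2 (g := a) (b := b) (c := c) hab hac hbc (Function.update_self _ _ _)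
    (by rw [Function.update_of_ne hab.symm, e2b]) (by rw [Function.update_of_ne hac.symm, e2c]) (j := (U a).2 + 2)
    (add_two_ne _) ?_
  have hS := M.shiftP_by (M.permP _ hQ1 (Equiv.swap a d)) 2
  refine M.congrP hS (fun i => ?_)
  dsimp only
  rcases fin4_cover hab hac had hbc hbd hcd i with hi | hi | hi | hi <;> rw [hi]
  · left
    rw [Equiv.swap_apply_left, Function.update_self, Function.update_of_ne hac, Function.update_self]
    exact Prod.ext rfl ((by decide : ∀ k : Fin 4, k + 2 + 2 = k) _)
  · right
    rw [Equiv.swap_apply_of_ne_of_ne hab.symm hbd, Function.update_of_ne hbd, Function.update_self,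
      Function.update_of_ne hbc, Function.update_of_ne hab.symm, Function.update_self]
    exact ⟨rfl, rfl⟩
  · left
    rw [Equiv.swap_apply_of_ne_of_ne hac.symm hcd, Function.update_of_ne hcd, Function.update_of_ne hbc.symm,
      Function.update_of_ne hcd, e1c, Function.update_self]
  · right
    rw [Equiv.swap_apply_right, Function.update_of_ne had, Function.update_of_ne hab, Function.update_of_ne had, e1a,
      Function.update_of_ne hcd.symm, Function.update_of_ne had.symm, Function.update_of_ne hbd.symm,
      Function.update_of_ne had.symm, e2d]
    exact ⟨rfl, rfl⟩

end LineModel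

/-- unit tag words of one parity class with two different tags: type `0002` or `0022` read from a slot `s` (finite check). -/
theorem anti_unit_tags_aux : ∀ x0 x1 x2 x3 : Fin 4,
    (∀ f g : Fin 4, (![x0, x1, x2, x3] f).val % 2 = (![x0, x1, x2, x3] g).val % 2) →
    (∃ f g : Fin 4, ![x0, x1, x2, x3] f ≠ ![x0, x1, x2, x3] g) →
    ∃ s : Fin 4,
      (![x0, x1, x2, x3] (s + 2) = ![x0, x1, x2, x3] (s + 1) ∧ ![x0, x1, x2, x3] (s + 3) = ![x0, x1, x2, x3] (s + 1) ∧
          ![x0, x1, x2, x3] s = ![x0, x1, x2, x3] (s + 1) + 2) ∨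
      (![x0, x1, x2, x3] (s + 1) = ![x0, x1, x2, x3] s ∧ ![x0, x1, x2, x3] (s + 2) = ![x0, x1, x2, x3] s + 2 ∧
          ![x0, x1, x2, x3] (s + 3) = ![x0, x1, x2, x3] s + 2) ∨
      (![x0, x1, x2, x3] (s + 2) = ![x0, x1, x2, x3] s ∧ ![x0, x1, x2, x3] (s + 1) = ![x0, x1, x2, x3] s + 2 ∧
          ![x0, x1, x2, x3] (s + 3) = ![x0, x1, x2, x3] s + 2) ∨
      (![x0, x1, x2, x3] (s + 3) = ![x0, x1, x2, x3] s ∧ ![x0, x1, x2, x3] (s + 1) = ![x0, x1, x2, x3] s + 2 ∧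
          ![x0, x1, x2, x3] (s + 2) = ![x0, x1, x2, x3] s + 2) := by
  decide

namespace LineModel

variable {h : ℤ} {vN vP : ACell → Prop}

/-- **FC SHAPE BELOW TWELVE on `P` (PROVED, h-uniform)**: a fully charged `P`-cell of an abstract model of height `< 12` has four
equal tags, or is the unit cell `P[1_k@a, 1_k@b, 1_{k+2}@c, 1_{k+2}@d]`. -/
theorem fcP_shape_below_twelve (M : LineModel h vN vP) (hh : h < 12) {X : ACell} (hP : vP X) (hc : ∀ f, 1 ≤ (X f).1) :
    (∀ f g : Fin 4, (X f).2 = (X g).2) ∨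
      ((∀ f, (X f).1 = 1) ∧ ∃ a b c d : Fin 4, a ≠ b ∧ a ≠ c ∧ a ≠ d ∧ b ≠ c ∧ b ≠ d ∧ c ≠ d ∧
        (X b).2 = (X a).2 ∧ (X c).2 = (X a).2 + 2 ∧ (X d).2 = (X a).2 + 2) := by
  by_cases hpure : ∀ f g : Fin 4, (X f).2 = (X g).2
  · exact Or.inl hpure
  right
  push Not at hpure
  obtain ⟨f, g, hfg⟩ := hpure
  have hpar : ∀ a b : Fin 4, (X a).2.val % 2 = (X b).2.val % 2 := by
    intro a b
    by_contra hne
    exact ((abstractAntipodalFC_of_lt_twelve hh) vN vP M X ⟨hc, a, b, hne⟩).2 hP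
  have hunit : ∀ i, (X i).1 = 1 := by
    intro i
    by_contra hi
    have hi2 : 2 ≤ (X i).1 := by have := hc i; omega
    exact hfg (by rw [M.fcP_tags_const_of_two hh hP hc hi2 f, M.fcP_tags_const_of_two hh hP hc hi2 g])
  refine ⟨hunit, ?_⟩
  have e : ![(X 0).2, (X 1).2, (X 2).2, (X 3).2] = fun i => (X i).2 := by funext i; fin_cases i <;> rfl
  have hs' := anti_unit_tags_aux (X 0).2 (X 1).2 (X 2).2 (X 3).2 (by rw [e]; exact hpar) (by rw [e]; exact ⟨f, g, hfg⟩)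
  rw [e] at hs'
  obtain ⟨s, hs⟩ := hs'
  obtain ⟨h1, h2, h3, h12, h13, h23⟩ := fin4_others s
  rcases hs with ⟨e2, e3, e0⟩ | ⟨e1, e2, e3⟩ | ⟨e2, e1, e3⟩ | ⟨e3, e1, e2⟩
  · exact (M.units_0002_absent hh hP (a := s + 1) (b := s + 2) (c := s + 3) (d := s) h12 h13 h1 h23 h2 h3
      (hunit _) (hunit _) (hunit _) (hunit _) e2 e3 e0).elim
  · exact ⟨s, s + 1, s + 2, s + 3, h1.symm, h2.symm, h3.symm, h12, h13, h23, e1, e2, e3⟩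
  · exact ⟨s, s + 2, s + 1, s + 3, h2.symm, h1.symm, h3.symm, h12.symm, h23, h13, e2, e1, e3⟩
  · exact ⟨s, s + 3, s + 1, s + 2, h3.symm, h1.symm, h2.symm, h13.symm, h23.symm, h12, e3, e1, e2⟩

end LineModel

/-- **THE FC SHAPE LAW BELOW TWELVE (PROVED, h-uniform)**: in a `G₁`-static RULE-D∕`X+` effective LINE design of height `h < 12` every
fully charged `N`-cell is phase-pure, and every fully charged `P`-cell is phase-pure or the unit cell `P((1,k),(1,k),(1,k+2),(1,k+2))`
(which IS present at ten — MACHINE, falsifier (a)).  With Part K: below ten every FC cell is pure; heights `10, 11` add this one shape. -/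
theorem fcShapeLine_of_lt_twelve {h : ℤ} (hh : h < 12) {C : MConfig} (hC : LSupport h C) (hG : C.G1Closed)
    (hD : RuleDMu4Closed C) (hXp : XPlusClosed C) :
    (∀ Z ∈ C.lower, FCc Z → PureCell h Z) ∧
    (∀ Z ∈ C.upper, FCc Z → PureCell h Z ∨ ∃ k : Fin 4, ∃ a b c d : Fin 4, a ≠ b ∧ a ≠ c ∧ a ≠ d ∧ b ≠ c ∧ b ≠ d ∧ c ≠ d ∧
      Z a = lineLetter h 1 k ∧ Z b = lineLetter h 1 k ∧ Z c = lineLetter h 1 (k + 2) ∧ Z d = lineLetter h 1 (k + 2)) := by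
  have hM := lineModel_of_config hC hG hD hXp
  refine ⟨fun Z hZ hFC => ?_, fun Z hZ hFC => ?_⟩
  · obtain ⟨X, rfl⟩ := exists_realize (hC.1 Z hZ)
    have hc := charges_pos_of_fcc hFC
    refine ⟨(X 0).2, fun f c k e _ => ?_⟩
    rw [realize_apply] at e
    obtain ⟨-, hk⟩ := lineLetter_inj (hc f) e
    rw [← hk]
    exact hM.fcN_tags_const hZ hc hh f 0
  · obtain ⟨X, rfl⟩ := exists_realize (hC.2 Z hZ)
    have hc := charges_pos_of_fcc hFC
    rcases hM.fcP_shape_below_twelve hh hZ hc with heq | ⟨hunit, a, b, c, d, hab, hac, had, hbc, hbd, hcd, eb, ec, ed⟩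
    · left
      refine ⟨(X 0).2, fun f c k e _ => ?_⟩
      rw [realize_apply] at e
      obtain ⟨-, hk⟩ := lineLetter_inj (hc f) e
      rw [← hk]
      exact heq f 0
    · right
      refine ⟨(X a).2, a, b, c, d, hab, hac, had, hbc, hbd, hcd, ?_, ?_, ?_, ?_⟩
      · rw [realize_apply, hunit a]
      · rw [realize_apply, hunit b, eb]
      · rw [realize_apply, hunit c, ec]
      · rw [realize_apply, hunit d, ed]

end Summit.Ventures.HSemireg.Pad4Tower.LinePhaseRigidity
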